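import Summits.CriticalPhenomena.CardyFormulaZ2.Theorems.RectilinearCardy.Negative.RectilinearCardyLShape
import Summits.CriticalPhenomena.CardyFormulaZ2.Theorems.CardyAnchoredRigiditySubseqCardySquareCardy
import Literature.Probability.RandomPlanarGeometry.RectangleModulusAspectRatio
import Literature.Probability.Percolation.CardyFormula

/-!
# Stub `stub_heartLShape` (line `registered`, crux `SimilarityUpgrade`, stmt-CriticalPhenomena-4597)

Crux `Summit.CriticalPhenomena.CardyFormulaZ2.Theses.CardyWhiteToColoured.SimilarityUpgrade`,
route `CardyWhiteToColoured`, sub-problem `CardyFormulaZ2`, line `registered`, stub **E**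
`stub_heartLShape`: the open heart H3 of the crux — a full bond-`ℤ²` crossing limit `Φ` takes the
same value on a rectilinear quad `R` and on the corner-marked box
`R' = ((0,w)×(0,1); i, 0, w, w+i)` (arcs `0/2` = left/right sides) of equal conformal modulus — at
its first non-similar instance `R = lShapeQuad` (the L-shape `((0,2)² ∖ [1,2]²; 0, 2, 1+i, 2i)`),
GIVEN that the L-shape is crossed with probability `→ 1/2` (hypothesis 1, a neighbouring stub).

Proof.
* `Φ lShapeQuad = 1/2`: uniqueness of limits along the non-trivial filter `𝓝[>] 0`.
* Every uniformizing datum of the L-shape has cross-ratio `1/2` (`crossRatio_lShapeQuad`, the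
  diagonal symmetry), so by the equal-modulus hypothesis `crossRatio x' = 1/2`.
* `w = 1`: by Bollobás–Riordan's `rectangle_crossRatio_eq_of_aspectRatio_holds` the modulus of the
  corner-marked box `(0,w)×(0,1)` is `η w` for a strictly antitone `η` on `(0,∞)`; the unit box
  `brRect 1 1` has modulus `1/2` by the tree's symmetry principle
  `ConformalRectangle.crossRatio_eq_half_of_antiAffine` for the anti-diagonal reflection
  `z ↦ -i z̄ + 1 + i` (it preserves `(0,1)²`, fixes the marks `i`, `1` and swaps `0 ↔ 1 + i`), so
  `η w = 1/2 = η 1` and `w = 1` by injectivity.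
* `Φ R' = 1/2`: `R'` is then the unit square crossed left-to-right, whose bond-`ℤ²` crossing
  probability tends to `1/2` (`tendsto_bondDomainCrossingProb_lrSquare`); uniqueness of limits again.

No definitions are introduced.

References: B. Bollobás, O. Riordan, *Percolation* (2006), Ch. 7 §7.1 p. 184 (the modulus of a
rectangle is a strictly decreasing function of the aspect ratio); L. V. Ahlfors, *Complex Analysis*
(1979), Ch. 4 §6.5 (reflection principle); J. Cardy, J. Phys. A 25 (1992) L201.
-/

noncomputable section

namespace Summit.CriticalPhenomena.CardyFormulaZ2.Cruxes.SimilarityUpgrade.Stubs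

open Filter Topology Set MeasureTheory
open Literature.Probability.RandomPlanarGeometry
open Literature.Probability.Percolation
open Summit.CriticalPhenomena.CardyFormulaZ2.Theorems.RectilinearCardy.Negative (brRect brRect_carrier
  brRect_pt crossRatio_lShapeQuad isUniformizing_modulusDatum)

/-- The anti-diagonal reflection `z ↦ -i z̄ + 1 + i`, i.e. `x + iy ↦ (1 - y) + i (1 - x)`, maps the
open unit box `(0,1)²` into itself. [folklore] -/
theorem heartLShape_mapsTo_antiAffine_unitBox :
    MapsTo (antiAffine (-Complex.I) (1 + Complex.I)) (brRect 1 1 one_pos one_pos).carrier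
      (brRect 1 1 one_pos one_pos).carrier := by
  intro z hz
  rw [brRect_carrier, Complex.mem_reProdIm, mem_Ioo, mem_Ioo] at hz ⊢
  have hre : (antiAffine (-Complex.I) (1 + Complex.I) z).re = 1 - z.im := by
    simp [antiAffine, neg_add_eq_sub]
  have him : (antiAffine (-Complex.I) (1 + Complex.I) z).im = 1 - z.re := by
    simp [antiAffine, neg_add_eq_sub]
  rw [hre, him]
  obtain ⟨⟨h1, h2⟩, h3, h4⟩ := hz
  refine ⟨⟨?_, ?_⟩, ?_, ?_⟩ <;> linarith

/-- **The corner-marked unit box `((0,1)²; i, 0, 1, 1+i)` has conformal modulus `1/2`** for every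
uniformizing datum: the anti-diagonal reflection `z ↦ -i z̄ + 1 + i` preserves the box, fixes the
marks `i` and `1` and swaps `0 ↔ 1 + i` (tree symmetry principle
`ConformalRectangle.crossRatio_eq_half_of_antiAffine`). [folklore] -/
theorem heartLShape_crossRatio_unitBox
    {φ : ConformalEquiv UpperHalfPlane.upperHalfPlaneSet (brRect 1 1 one_pos one_pos).carrier}
    {x : Fin 4 → ℝ} (h : (brRect 1 1 one_pos one_pos).IsUniformizing φ x) : crossRatio x = 1 / 2 := by
  obtain ⟨h0, h1, h2, h3⟩ := brRect_pt 1 1 one_pos one_pos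
  refine ConformalRectangle.crossRatio_eq_half_of_antiAffine (brRect 1 1 one_pos one_pos)
    (u := -Complex.I) (v := 1 + Complex.I) (by simp) ?_ heartLShape_mapsTo_antiAffine_unitBox ?_ ?_ ?_ h
  · apply Complex.ext <;> simp
  · rw [h0]; apply Complex.ext <;> simp [antiAffine]
  · rw [h2]; apply Complex.ext <;> simp [antiAffine]
  · rw [h1, h3]; apply Complex.ext <;> simp [antiAffine]

/-- **A corner-marked box `((0,w)×(0,1); i, 0, w, w+i)` of conformal modulus `1/2` is the unit
square**: the modulus of the box is a strictly antitone function `η w` of the aspect ratio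
(Bollobás–Riordan, `rectangle_crossRatio_eq_of_aspectRatio_holds`) and `η 1 = 1/2`
(`heartLShape_crossRatio_unitBox`). [cite: BollobasRiordan2006, Ch. 7 §7.1 p. 184] -/
theorem heartLShape_width_eq_one (R' : ConformalRectangle) {w : ℝ} (hw : 0 < w)
    (hcar : R'.carrier = (Ioo (0 : ℝ) w ×ℂ Ioo (0 : ℝ) 1))
    (hpt : R'.pt 0 = Complex.I ∧ R'.pt 1 = 0 ∧ R'.pt 2 = (w : ℂ) ∧ R'.pt 3 = (w : ℂ) + Complex.I)
    {φ' : ConformalEquiv UpperHalfPlane.upperHalfPlaneSet R'.carrier} {x' : Fin 4 → ℝ}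
    (hφ' : R'.IsUniformizing φ' x') (hx' : crossRatio x' = 1 / 2) : w = 1 := by
  obtain ⟨η, hanti, -, hmod⟩ := rectangle_crossRatio_eq_of_aspectRatio_holds
  obtain ⟨p0, p1, p2, p3⟩ := hpt
  -- the modulus of `R'` is `η w`
  have hw' : crossRatio x' = η w := by
    have key := hmod R' w 1 hw one_pos hcar ⟨by rw [p0]; simp, p1, p2, by rw [p3]; simp⟩ φ' x' hφ'
    rwa [div_one] at key
  -- the modulus of the unit box is `η 1`
  have h1 : η 1 = 1 / 2 := by
    have key := hmod (brRect 1 1 one_pos one_pos) 1 1 one_pos one_pos (brRect_carrier 1 1 one_pos one_pos)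
      (by simpa using brRect_pt 1 1 one_pos one_pos) _ _ (isUniformizing_modulusDatum _)
    rw [div_one] at key
    exact key.symm.trans (heartLShape_crossRatio_unitBox (isUniformizing_modulusDatum _))
  exact hanti.injOn (mem_Ioi.2 hw) (mem_Ioi.2 one_pos) (by rw [← hw', hx', h1])

/-- **stub_heartLShape (E).** The heart H3 of the crux at `R = lShapeQuad`: if the L-shape is
crossed with probability `→ 1/2`, then every full bond-`ℤ²` crossing limit `Φ` takes the same value
on the L-shape and on any corner-marked box `((0,w)×(0,1); i, 0, w, w+i)` (crossed left-to-right)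
of the same conformal modulus — because that modulus is `1/2` (`crossRatio_lShapeQuad`), which
forces `w = 1` (`heartLShape_width_eq_one`), and the unit square is crossed with probability `→ 1/2`
(`tendsto_bondDomainCrossingProb_lrSquare`); limits along `𝓝[>] 0` are unique. [folklore] -/
theorem stub_heartLShape :
    Tendsto (bondDomainCrossingProb Summit.CriticalPhenomena.CardyFormulaZ2.Theorems.RectilinearCardy.Negative.lShapeQuad) (𝓝[>] (0 : ℝ)) (𝓝 (1 / 2)) →
    ∀ Φ : ConformalRectangle → ℝ,
      (∀ R : ConformalRectangle, Tendsto (bondDomainCrossingProb R) (𝓝[>] (0 : ℝ)) (𝓝 (Φ R))) →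
      ∀ R' : ConformalRectangle,
        (∃ w : ℝ, 0 < w ∧ R'.carrier = (Ioo (0 : ℝ) w ×ℂ Ioo (0 : ℝ) 1) ∧
          R'.arc 0 = {z : ℂ | z.re = 0 ∧ z.im ∈ Icc (0 : ℝ) 1} ∧
          R'.arc 2 = {z : ℂ | z.re = w ∧ z.im ∈ Icc (0 : ℝ) 1} ∧
          R'.pt 0 = Complex.I ∧ R'.pt 1 = 0 ∧ R'.pt 2 = (w : ℂ) ∧ R'.pt 3 = (w : ℂ) + Complex.I) →
        ∀ (φ : ConformalEquiv UpperHalfPlane.upperHalfPlaneSet Summit.CriticalPhenomena.CardyFormulaZ2.Theorems.RectilinearCardy.Negative.lShapeQuad.carrier) (x : Fin 4 → ℝ)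
          (φ' : ConformalEquiv UpperHalfPlane.upperHalfPlaneSet R'.carrier) (x' : Fin 4 → ℝ),
          Summit.CriticalPhenomena.CardyFormulaZ2.Theorems.RectilinearCardy.Negative.lShapeQuad.IsUniformizing φ x → R'.IsUniformizing φ' x' → crossRatio x = crossRatio x' →
          Φ Summit.CriticalPhenomena.CardyFormulaZ2.Theorems.RectilinearCardy.Negative.lShapeQuad = Φ R' := by
  intro hL Φ hlim R' hR' φ x φ' x' hφ hφ' hxx'
  obtain ⟨w, hw, hcar, ha0, ha2, hpt⟩ := hR'
  -- `Φ lShapeQuad = 1/2`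
  have hΦL : Φ Summit.CriticalPhenomena.CardyFormulaZ2.Theorems.RectilinearCardy.Negative.lShapeQuad = 1 / 2 :=
    tendsto_nhds_unique (hlim _) hL
  -- the common modulus is `1/2`, so `w = 1`
  have hx' : crossRatio x' = 1 / 2 := hxx' ▸ crossRatio_lShapeQuad hφ
  obtain rfl : w = 1 := heartLShape_width_eq_one R' hw hcar hpt hφ' hx'
  -- `Φ R' = 1/2`: the unit square crossed left-to-right
  have hR'lim : Tendsto (bondDomainCrossingProb R') (𝓝[>] (0 : ℝ)) (𝓝 (1 / 2)) :=
    Summit.CriticalPhenomena.CardyFormulaZ2.Cruxes.SubseqCardy.Birth.tendsto_bondDomainCrossingProb_lrSquare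
      (x₀ := 0) (y₀ := 0) one_pos R' (by simpa using hcar) (by simpa using ha0) (by simpa using ha2)
  have hΦR' : Φ R' = 1 / 2 := tendsto_nhds_unique (hlim R') hR'lim
  rw [hΦL, hΦR']

end Summit.CriticalPhenomena.CardyFormulaZ2.Cruxes.SimilarityUpgrade.Stubs

end
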